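import Mathlib
import Summits.ValiantsHypothesis.ValiantsHypothesis.Theses.ContractivityPrice
import Summits.ValiantsHypothesis.ValiantsHypothesis.Theses.DetQP
import Literature.Analysis.OperatorTheory.ContractiveDetComplexity
import Literature.Computability.AlgebraicComplexity.DeterminantalComplexity
import Literature.Computability.AlgebraicComplexity.DeterminantalComplexityProofs
import Summits.ValiantsHypothesis.ValiantsHypothesis.Theorems.ContractivityPriceContractiveHardnessSurjectiveReduction
import Summits.ValiantsHypothesis.ValiantsHypothesis.Theorems.DetqpThesis.Negative.Variants

/-!
# `ContractivityPrice.ContractiveHardness` follows from `DetQP.DetqpThesis` (extended VH)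

Crux `ContractiveHardness` (stmt-ValiantsHypothesis-10584, K2 of route
`ValiantsHypothesis/ContractivityPrice`): the stabilised permanent `Q_n = per_n(I + z/(4n))` has no
quasi-polynomial CONTRACTIVE realization `Q_n = a · det(I_R + diag(z ∘ κ) K)`, `‖K‖ ≤ 1`.

This file records, once and for all in the tree, the logical position that every grounder /
refuter note of the item states informally: the crux is IMPLIED by the extended Valiant hypothesis
`DetQP.DetqpThesis` ("`dc(per_n)` is not quasi-polynomially bounded"), because

* a contractive realization of size `R` is in particular an affine determinantal representation of
  size `R` (`Literature.Analysis.OperatorTheory.HasContractiveDetRepr.hasDetRepr`; the norm is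
  simply forgotten), so `dc(Q_n) ≤ cdc(Q_n)`;
* `dc(per_n) ≤ dc(Q_n)` for `n ≥ 1`: the stabilising substitution `x_e ↦ δ_e + x_e/(4n)` is an
  affine change of variables with affine inverse `x_e ↦ 4n (x_e − δ_e)`, and affine substitutions
  preserve affine determinantal representations of a given size
  (`hasDetRepr_perPoly_of_hasDetRepr_stabPer`, the converse of the route support
  `StabilisedPerDetRepr`);
* `dc(per_0) = 0` (`dcPer_zero`).

Hence `¬ ContractiveHardness` (some `c` with contractive realizations of `Q_n` of size
`≤ 2^((log₂ n + c)^c)` for EVERY `n`) makes `n ↦ dc(per_n)` quasi-polynomially bounded, i.e.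
`¬ DetqpThesis`.  Consequently any refutation of the crux refutes the extended Valiant hypothesis
over `ℂ`, and — the refuter's "mutation" remark made formal — a proof of the crux that never uses
the norm hypothesis `‖K‖ ≤ 1` would prove `DetqpThesis` itself.  Helper file of the line
`registered` (lead c2); it supports, and does not close, the item.
-/

noncomputable section

namespace Summit.ValiantsHypothesis.ValiantsHypothesis.Theorems

open MvPolynomial Matrix Literature.Analysis.OperatorTheory
open Literature.Computability.AlgebraicComplexity

set_option linter.dupNamespace false

/-- **Un-stabilising an affine determinantal representation** (`n ≥ 1`): an affine determinantal
representation of `Q_n = per_n(I + z/(4n))` of size `m` yields one of `per_n` of the same size —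
apply the inverse affine substitution `x_e ↦ 4n (x_e − δ_e)` entrywise (determinants commute with
algebra maps, affine entries stay affine).  Hence `dc(per_n) ≤ dc(Q_n)`. [folklore] -/
theorem hasDetRepr_perPoly_of_hasDetRepr_stabPer {n m : ℕ} (hn : 1 ≤ n)
    (h : HasDetRepr (MvPolynomial.aeval (fun e : Fin n × Fin n =>
        MvPolynomial.C (if e.1 = e.2 then (1 : ℂ) else 0) +
          MvPolynomial.C ((4 * (n : ℂ))⁻¹) * MvPolynomial.X e) (perPoly (Fin n) ℂ)) m) :
    HasDetRepr (perPoly (Fin n) ℂ) m := by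
  obtain ⟨A, hA, hdet⟩ := h
  have hc : (4 * (n : ℂ)) ≠ 0 :=
    mul_ne_zero (by norm_num) (Nat.cast_ne_zero.mpr (by omega))
  set φ : Fin n × Fin n → MvPolynomial (Fin n × Fin n) ℂ := fun e =>
    MvPolynomial.C (if e.1 = e.2 then (1 : ℂ) else 0) +
      MvPolynomial.C ((4 * (n : ℂ))⁻¹) * MvPolynomial.X e with hφ
  set ψ : Fin n × Fin n → MvPolynomial (Fin n × Fin n) ℂ := fun e =>
    MvPolynomial.C (4 * (n : ℂ)) * (MvPolynomial.X e - MvPolynomial.C (if e.1 = e.2 then (1 : ℂ) else 0))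
    with hψ
  -- `ψ ∘ φ = id` on `ℂ[z]`
  have hψφ : (MvPolynomial.aeval ψ).comp (MvPolynomial.aeval φ) =
      AlgHom.id ℂ (MvPolynomial (Fin n × Fin n) ℂ) := by
    rw [MvPolynomial.comp_aeval]
    have hid : (fun i => MvPolynomial.aeval ψ (φ i)) = MvPolynomial.X := by
      funext i
      have h1 : MvPolynomial.aeval ψ (φ i) =
          MvPolynomial.C (if i.1 = i.2 then (1 : ℂ) else 0) +
            MvPolynomial.C ((4 * (n : ℂ))⁻¹) * (MvPolynomial.C (4 * (n : ℂ)) *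
              (MvPolynomial.X i - MvPolynomial.C (if i.1 = i.2 then (1 : ℂ) else 0))) := by
        simp only [hφ, hψ, map_add, map_mul, MvPolynomial.aeval_C, MvPolynomial.aeval_X,
          MvPolynomial.algebraMap_eq]
      rw [h1, ← mul_assoc, ← map_mul, inv_mul_cancel₀ hc, map_one, one_mul]
      ring
    rw [hid, MvPolynomial.aeval_X_left]
  -- the inverse substitution is affine
  have hψ1 : ∀ e, (ψ e).totalDegree ≤ 1 := by
    intro e
    refine (totalDegree_mul _ _).trans ?_
    rw [totalDegree_C, zero_add]
    refine (totalDegree_sub _ _).trans (max_le ?_ ?_)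
    · rw [totalDegree_X]
    · rw [totalDegree_C]; exact Nat.zero_le _
  refine ⟨(MvPolynomial.aeval ψ).mapMatrix A, fun i j => ?_, ?_⟩
  · rw [AlgHom.mapMatrix_apply, Matrix.map_apply]
    exact (HasDetRepr.totalDegree_aeval_le_of_le_one _ hψ1 _).trans (hA i j)
  · rw [← AlgHom.map_det, hdet]
    change ((MvPolynomial.aeval ψ).comp (MvPolynomial.aeval φ)) (perPoly (Fin n) ℂ) = _
    rw [hψφ, AlgHom.id_apply]

/-- **`cdc ≥ dc` at the crux**: a contractive realization of `Q_n` of size `R` in the form inlined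
by `ContractiveHardness` gives `dc(per_n) ≤ R` (`n ≥ 1`). [folklore] -/
theorem determinantalComplexity_perPoly_le_of_contractive_realization {n R : ℕ} (hn : 1 ≤ n)
    {a : ℂ} {K : Matrix (Fin R) (Fin R) ℂ} {κ : Fin R → Fin n × Fin n}
    (hK : ‖Matrix.toEuclideanCLM (𝕜 := ℂ) K‖ ≤ 1)
    (hQ : MvPolynomial.aeval (fun e : Fin n × Fin n =>
        MvPolynomial.C (if e.1 = e.2 then (1 : ℂ) else 0) +
          MvPolynomial.C ((4 * (n : ℂ))⁻¹) * MvPolynomial.X e) (perPoly (Fin n) ℂ) =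
      MvPolynomial.C a * (1 + Matrix.diagonal (fun i => MvPolynomial.X (κ i)) *
        K.map (fun a : ℂ => (MvPolynomial.C a : MvPolynomial (Fin n × Fin n) ℂ))).det) :
    determinantalComplexity (perPoly (Fin n) ℂ) ≤ R := by
  have h0 : MvPolynomial.eval 0 (MvPolynomial.aeval (fun e : Fin n × Fin n =>
        MvPolynomial.C (if e.1 = e.2 then (1 : ℂ) else 0) +
          MvPolynomial.C ((4 * (n : ℂ))⁻¹) * MvPolynomial.X e) (perPoly (Fin n) ℂ)) = 1 := by
    exact (DFunLike.congr_fun MvPolynomial.eval_zero _).trans constantCoeff_stabPer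
  have hcdr : HasContractiveDetRepr (MvPolynomial.aeval (fun e : Fin n × Fin n =>
        MvPolynomial.C (if e.1 = e.2 then (1 : ℂ) else 0) +
          MvPolynomial.C ((4 * (n : ℂ))⁻¹) * MvPolynomial.X e) (perPoly (Fin n) ℂ)) R :=
    (hasContractiveDetRepr_iff_exists_C_mul h0 R).mpr ⟨a, K, κ, hK, hQ⟩
  exact determinantalComplexity_le_of_hasDetRepr
    (hasDetRepr_perPoly_of_hasDetRepr_stabPer hn hcdr.hasDetRepr)

/-- **The crux is implied by the extended Valiant hypothesis**: `DetQP.DetqpThesis`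
(`n ↦ dc(per_n)` is not quasi-polynomially bounded) implies `ContractivityPrice.ContractiveHardness`
(no quasi-polynomial contractive realization of the stabilised permanent): a contractive
realization is an affine determinantal representation (the norm is forgotten) and the
stabilisation is an affine change of variables.  [cite: BurgisserClausenShokrollahi1997, Cor. 21.40
and Problem 21.5 (the extended hypothesis)] -/
theorem contractiveHardness_of_detqpThesis :
    Summit.ValiantsHypothesis.ValiantsHypothesis.Theses.DetQP.DetqpThesis →
      Summit.ValiantsHypothesis.ValiantsHypothesis.Theses.ContractivityPrice.ContractiveHardness := by
  intro hX
  unfold Summit.ValiantsHypothesis.ValiantsHypothesis.Theses.DetQP.DetqpThesis at hX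
  unfold Summit.ValiantsHypothesis.ValiantsHypothesis.Theses.ContractivityPrice.ContractiveHardness
  by_contra hCH
  apply hX
  push Not at hCH
  obtain ⟨c, hc⟩ := hCH
  refine ⟨c, fun n => ?_⟩
  show determinantalComplexity (perPoly (Fin n) ℂ) ≤ 2 ^ (Nat.log 2 n + c) ^ c
  obtain ⟨R, hR, a, K, κ, hK, hQ⟩ := hc n
  rcases Nat.eq_zero_or_pos n with h0 | hpos
  · subst h0
    rw [Summit.ValiantsHypothesis.Theorems.DetqpThesis.Negative.dcPer_zero]
    exact Nat.zero_le _
  · exact (determinantalComplexity_perPoly_le_of_contractive_realization hpos hK hQ).trans hR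

end Summit.ValiantsHypothesis.ValiantsHypothesis.Theorems

end
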